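/-
Copyright (c) 2026 the pub-hodgecm-mathlib formalisation cell (harness21).  Prover seat hodgecm-mathlib-LH4-p09 (g8), req620 Track A «(D-RAM) FOUR-FRAME» squad
(heir dealer LH4-plan (g13) WORD #87 ∕ #89 (d): second hand on (c) «the lev box-sum proof», FILE 3∕3 — the HEAD modulo FILE 2's arithmetic).  2026-09-04.
-/
import Summits.HodgeConjecture.HodgeConjecture.Theorems.F0P3cDyRamLevLabelledBoxSumDefs          -- ★ p860066∕p860094 (F0P3a-p01 (g36)): `LevLabelledBoxSum(Wide) ℓ₁ ℓ₂`
import Summits.HodgeConjecture.HodgeConjecture.Theorems.F0P3cDyRamLevBoxSumPlanes               -- ★ (F0P3a-p01 (g36)) (c) FILE 1∕3: `kappa_plane_sum_lev`, `kappa_diag_sum_lev`; brings ★ `…KappaCountBoxSumPlanes` (`vec_single_ite`, `vec_bracket_ite`)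
import Summits.HodgeConjecture.HodgeConjecture.Theorems.F0P3cDyRamStableCountBoxReindex         -- ★ B10 (LH4-p14 (g2)): `sum_box_eq_triple_sum`, `triple_sum_eq_diag_add_planes`, `vec3_eq_iff`
import HarnessLib

/-!
# (D-RAM) four-frame, STAGE 1b — (T-box | lev) (c) FILE 3∕3: THE HEAD `LevLabelledBoxSumWide ℓ₁ ℓ₂` MODULO THE ARITHMETIC OF FILE 2∕3

Helper brick for dealer LH4-plan (g13) WORD #87 ∕ #89 (d) (second hand on F0P3a-p01 (g36)'s (c); default cut at 12:58Z: «p09 starts FILE 3∕3 with FILE 2 pasted as a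
hypothesis»): `Theorems/` only, statement-first, ★-only imports, lane `--supports stmt-HodgeConjecture-24833 --as helper`; PAYS NO tier-0 row (count-neutral).
WHAT IT DOES (twin of LH4-p10 (g6)'s ★ `SqLabelledBoxSum_holds` steps (0)–(2)): inside `LevLabelledBoxSumWide ℓ₁ ℓ₂`, the off-shape vanishing `hzero` gives the regular-shape
dichotomy and the odd-`r` zeros; the glued rows `hG1∕hG2∕hG3` are rewritten into ★ FILE 1's `kappa_plane_sum_lev` currency (tube flag `i = p`, bracket
`brk p s c := (i = p → d ≤ s∕2 + c) ∧ (i ≠ p → d ≤ c)` — the vector `(εG p0·[2d ≤ s+E′+1], εG p1·[2d ≤ E′+1], εG p2·[2d ≤ E′+1])ᵢ` at `c = ⌈E′∕2⌉`, `2 ∣ s`, by ★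
`vec_single_ite` ∕ `vec_bracket_ite` and `ite_bracket_congr`); then ★ `sum_box_eq_triple_sum` + ★ `triple_sum_eq_diag_add_planes` + ★ `kappa_diag_sum_lev` + ★ `kappa_plane_sum_lev` (×3,
read legs `nr := n₂, n₁, n₂`) turn the box sum into the DIAGONAL WINDOW + three PLANE blocks (tube feet + cut windows); what remains — `(q − 1)·(those blocks) =
SIGN·(q^{k−X} − q^{k−max(X, B″+Y)})` — is the ARITHMETIC `hArith` (FILE 2∕3's statement, printed here as the hypothesis type token for token, for F0P3a-p01 (g36) to prove).
* `ite_bracket_congr` (bookkeeping) · **`levLabelledBoxSumWide_of_arith (hArith) (ℓ₁ ℓ₂) : LevLabelledBoxSumWide ℓ₁ ℓ₂`** · `levLabelledBoxSum_of_arith` (the narrow Prop, by ★ `levLabelledBoxSum_of_wide`).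

HONEST LABEL: helper, conditional on FILE 2∕3 (`hArith`); the lev laws stay OPEN until FILE 2 lands and LH4-p12 (g7)'s heads tie by name; STAGE-1b tier-0 rows and the ED. 5∕6∕7
law stubs OPEN; HC_CM is proved only modulo the 7 printed citations (2 remaining named inputs: hLiu418 = `stmt-HodgeConjecture-24832`, h413 = `stmt-HodgeConjecture-24833`) until rung 0 closes.

## References
* [Kottwitz1986BaseChangeUnits] R. E. Kottwitz, *Base change for unit elements of Hecke algebras*, Compositio Math. 60 (1986), §1 pp. 240–241 (κ-orbital integrals of units as signed lattice counts).
* [Rogawski1990] J. D. Rogawski, *Automorphic Representations of Unitary Groups in Three Variables*, Ann. of Math. Stud. 123 (1990), §4.9 Prop. 4.9.1 (a) p. 55; §4.10 p. 58.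
-/

set_option autoImplicit false

namespace Summit.HodgeConjecture.HodgeConjecture.Cruxes.H413.F0P3cDyRamLevLabelledKappaBoxSum

open Finset
open Summit.HodgeConjecture.HodgeConjecture.Cruxes.H413.F0P3cDyRamLevLabelledBoxSumDefs (LevLabelledBoxSum LevLabelledBoxSumWide levLabelledBoxSum_of_wide)
open Summit.HodgeConjecture.HodgeConjecture.Cruxes.H413.F0P3cDyRamStableCountBoxReindex (vec3_eq_iff sum_box_eq_triple_sum triple_sum_eq_diag_add_planes)
open Summit.HodgeConjecture.HodgeConjecture.Cruxes.H413.F0P3cDyRamKappaCountBoxSumPlanes (vec_single_ite vec_bracket_ite)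
open Summit.HodgeConjecture.HodgeConjecture.Cruxes.H413.F0P3cDyRamLevBoxSumPlanes (kappa_plane_sum_lev kappa_diag_sum_lev)

/-- Bookkeeping: the bracket of a glue-foot summand may be replaced by an equivalent one under the summand's own guard (the `Decidable` instances are implicit binders so
that `rw` reads them off the goal). [folklore] -/
theorem ite_bracket_congr {A B B' : Prop} {dA : Decidable A} {dB : Decidable B} [Decidable B'] (e P : ℚ) (h : A → (B ↔ B')) :
    (if A then (if B then e else 0) * P else 0) = (if A then (if B' then e else 0) * P else 0) := by
  by_cases hA : A
  · rw [if_pos hA, if_pos hA]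
    by_cases hB : B
    · rw [if_pos hB, if_pos ((h hA).1 hB)]
    · rw [if_neg hB, if_neg (fun h' => hB ((h hA).2 h'))]
  · rw [if_neg hA, if_neg hA]

/-- **(T-box | lev) FILE 3∕3 — `LevLabelledBoxSumWide ℓ₁ ℓ₂` FROM THE ARITHMETIC OF FILE 2∕3** (`hArith`: for every fenced isoceles key, `(q − 1)·(diagonal window + three plane
blocks of ★ FILE 1) = SIGN·(q^{k−X} − q^{k−max(X, B″+Y)})`, `X = max ℓ₁ (⌈ℓ₂∕2⌉ − ⌊d∕2⌋ + ⌈(ℓ₁−d%2)∕2⌉… )`, `Y = 2⌈(ℓ₁+1−d%2)∕2⌉∕…` as printed in ★ p860066).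
[cite: Kottwitz1986BaseChangeUnits, §1 pp. 240–241] [cite: Rogawski1990, §4.9 Prop. 4.9.1 (a) p. 55; §4.10 p. 58] -/
theorem levLabelledBoxSumWide_of_arith
    (hArith : ∀ (q d n₁ n₂ n₃ k ℓ₁ ℓ₂ : ℕ) (i : Fin 3) (ω εH : ℚ) (εG : Fin 3 → Fin 3 → ℚ),
      2 ≤ d → ((n₁ = n₂ ∧ n₁ ≤ n₃) ∨ (n₁ = n₃ ∧ n₁ ≤ n₂) ∨ (n₂ = n₃ ∧ n₂ ≤ n₁)) →
      (2 * d ≤ n₁ + 1 ∧ 2 * d ≤ n₂ + 1 ∧ 2 * d ≤ n₃ + 1) → ℓ₁ ≤ 2 → (ℓ₂ ≤ n₁ + ℓ₁ ∧ ℓ₂ ≤ n₂ + ℓ₁ ∧ ℓ₂ ≤ n₃ + ℓ₁) →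
      (d % 2 = 0 → ℓ₁ = 1 → d + 1 ≤ ℓ₂) → n₁ % 2 = d % 2 → n₂ % 2 = d % 2 → n₃ % 2 = d % 2 → 2 * k + d = n₁ + n₂ + n₃ + 2 →
      (i = 0 → n₂ = n₃ → n₂ + 2 * d ≤ n₁ → εG 0 0 = ω) → (i = 1 → n₁ = n₃ → n₁ + 2 * d ≤ n₂ → εG 1 1 = ω) →
      (i = 2 → n₁ = n₂ → n₁ + 2 * d ≤ n₃ → εG 2 2 = ω) →
      ((q : ℚ) - 1) *
          ((if n₁ = n₂ ∧ n₂ = n₃ then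
                  εH *
                    ∑
                      c ∈
                        Icc 1
                          (min (n₁ - ℓ₁ - (n₁ - ℓ₁) / 2)
                            (min ((2 * n₁ - ℓ₂) / 2 - (n₁ - ℓ₁) / 2) ((2 * n₁ - d + 1 - ℓ₁) / 2 - (n₁ - ℓ₁) / 2))),
                      if d ≤ c then (q : ℚ) ^ (2 * ((n₁ - ℓ₁) / 2) + c) else 0
                else 0) +
                ((if i = 0 then
                    ω *
                      (∑ j ∈ Icc d ((n₁ - ℓ₁) / 2), (q : ℚ) ^ j +
                        ∑ ρ ∈ Icc 1 (min (min n₂ n₃) (min (n₂ - ℓ₁) (2 * n₂ - ℓ₂)) / 2),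
                          ((if ρ + d ≤ (n₁ - ℓ₁) / 2 then (q : ℚ) ^ ((n₁ - ℓ₁) / 2 + ρ) - (q : ℚ) ^ (2 * ρ + d - 1) else 0) -
                            if ρ + d ≤ (n₁ - ℓ₁) / 2 + 1 then (q : ℚ) ^ (2 * ρ + d - 2) else 0))
                  else 0) +
                  if n₂ = n₃ ∧ n₂ < n₁ ∧ (n₁ - n₂) % 2 = 0 then
                    εG 0 i *
                      ∑
                        c ∈
                          Icc 1
                            (min (n₂ - ℓ₁ - (n₂ - ℓ₁) / 2)
                              (min ((2 * n₂ - ℓ₂) / 2 - (n₂ - ℓ₁) / 2) ((2 * n₂ - d + 1 - ℓ₁) / 2 - (n₂ - ℓ₁) / 2))),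
                        if (i = 0 → d ≤ (n₁ - n₂) / 2 + c) ∧ (i ≠ 0 → d ≤ c) then
                          (q : ℚ) ^ (2 * ((n₂ - ℓ₁) / 2) + (n₁ - n₂) / 2 + c)
                        else 0
                  else 0) +
              ((if i = 1 then
                  ω *
                    (∑ j ∈ Icc d ((n₂ - ℓ₁) / 2), (q : ℚ) ^ j +
                      ∑ ρ ∈ Icc 1 (min (min n₁ n₃) (min (n₁ - ℓ₁) (2 * n₁ - ℓ₂)) / 2),
                        ((if ρ + d ≤ (n₂ - ℓ₁) / 2 then (q : ℚ) ^ ((n₂ - ℓ₁) / 2 + ρ) - (q : ℚ) ^ (2 * ρ + d - 1) else 0) -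
                          if ρ + d ≤ (n₂ - ℓ₁) / 2 + 1 then (q : ℚ) ^ (2 * ρ + d - 2) else 0))
                else 0) +
                if n₁ = n₃ ∧ n₁ < n₂ ∧ (n₂ - n₁) % 2 = 0 then
                  εG 1 i *
                    ∑
                      c ∈
                        Icc 1
                          (min (n₁ - ℓ₁ - (n₁ - ℓ₁) / 2)
                            (min ((2 * n₁ - ℓ₂) / 2 - (n₁ - ℓ₁) / 2) ((2 * n₁ - d + 1 - ℓ₁) / 2 - (n₁ - ℓ₁) / 2))),
                      if (i = 1 → d ≤ (n₂ - n₁) / 2 + c) ∧ (i ≠ 1 → d ≤ c) then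
                        (q : ℚ) ^ (2 * ((n₁ - ℓ₁) / 2) + (n₂ - n₁) / 2 + c)
                      else 0
                else 0) +
            ((if i = 2 then
                ω *
                  (∑ j ∈ Icc d ((n₃ - ℓ₁) / 2), (q : ℚ) ^ j +
                    ∑ ρ ∈ Icc 1 (min (min n₁ n₂) (min (n₂ - ℓ₁) (2 * n₂ - ℓ₂)) / 2),
                      ((if ρ + d ≤ (n₃ - ℓ₁) / 2 then (q : ℚ) ^ ((n₃ - ℓ₁) / 2 + ρ) - (q : ℚ) ^ (2 * ρ + d - 1) else 0) -
                        if ρ + d ≤ (n₃ - ℓ₁) / 2 + 1 then (q : ℚ) ^ (2 * ρ + d - 2) else 0))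
              else 0) +
              if n₁ = n₂ ∧ n₁ < n₃ ∧ (n₃ - n₁) % 2 = 0 then
                εG 2 i *
                  ∑
                    c ∈
                      Icc 1
                        (min (n₁ - ℓ₁ - (n₁ - ℓ₁) / 2)
                          (min ((2 * n₁ - ℓ₂) / 2 - (n₁ - ℓ₁) / 2) ((2 * n₁ - d + 1 - ℓ₁) / 2 - (n₁ - ℓ₁) / 2))),
                    if (i = 2 → d ≤ (n₃ - n₁) / 2 + c) ∧ (i ≠ 2 → d ≤ c) then (q : ℚ) ^ (2 * ((n₁ - ℓ₁) / 2) + (n₃ - n₁) / 2 + c)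
                    else 0
              else 0)) =
        (if n₁ = n₂ ∧ n₂ = n₃ then εH else if n₂ = n₃ then εG 0 i else if n₁ = n₃ then εG 1 i else εG 2 i) *
          ((q : ℚ) ^ (k - max ℓ₁ ((ℓ₂ + 1) / 2 - d / 2 + (ℓ₁ + 1 - d % 2) / 2)) -
            (q : ℚ) ^
              (k -
                max (max ℓ₁ ((ℓ₂ + 1) / 2 - d / 2 + (ℓ₁ + 1 - d % 2) / 2))
                  (((![n₁, n₂, n₃] : Fin 3 → ℕ) i + 2 * (d % 2) + 2 - 3 * d) / 2 + 2 * ((ℓ₁ + 1 - d % 2) / 2)))))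
    (ℓ₁ ℓ₂ : ℕ) : LevLabelledBoxSumWide ℓ₁ ℓ₂ := by
  intro q d n₁ n₂ n₃ Bx k hd hiso hfence hℓ₁ hℓ₂ hcorner h1 h2 h3 hBx hk i ω εH εG hω0 hω1 hω2 v hcore hT1 hT2 hT3 hG1 hG2 hG3 hH hzero
  obtain ⟨hf1, hf2, hf3⟩ := hfence
  -- depths exceed `d + 2` (fence + parity, `d ≥ 2`)
  have hdn₁ : d + 2 ≤ n₁ := by omega
  have hdn₂ : d + 2 ≤ n₂ := by omega
  have hdn₃ : d + 2 ≤ n₃ := by omega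
  -- (0) the off-shape cells vanish (★ p856906 (0) verbatim)
  have hz_diag : ∀ r, 1 ≤ r → ¬ 2 ∣ r → v ![r, r, r] = 0 := fun r hr hr2 => hzero _ (by
    rintro (h | ⟨s', hs', -, h | h | h⟩ | ⟨ρ, s', hρ, hs', -, h | h | h⟩ | ⟨ρ, hρ, h⟩) <;> rw [vec3_eq_iff] at h <;> omega)
  have hz_p1 : ∀ r s, 1 ≤ r → ¬ 2 ∣ r → 1 ≤ s → v ![r, r + s, r + s] = 0 := fun r s hr hr2 hs => hzero _ (by
    rintro (h | ⟨s', hs', -, h | h | h⟩ | ⟨ρ, s', hρ, hs', -, h | h | h⟩ | ⟨ρ, hρ, h⟩) <;> rw [vec3_eq_iff] at h <;> omega)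
  have hz_p2 : ∀ r s, 1 ≤ r → ¬ 2 ∣ r → 1 ≤ s → v ![r + s, r, r + s] = 0 := fun r s hr hr2 hs => hzero _ (by
    rintro (h | ⟨s', hs', -, h | h | h⟩ | ⟨ρ, s', hρ, hs', -, h | h | h⟩ | ⟨ρ, hρ, h⟩) <;> rw [vec3_eq_iff] at h <;> omega)
  have hz_p3 : ∀ r s, 1 ≤ r → ¬ 2 ∣ r → 1 ≤ s → v ![r + s, r + s, r] = 0 := fun r s hr hr2 hs => hzero _ (by
    rintro (h | ⟨s', hs', -, h | h | h⟩ | ⟨ρ, s', hρ, hs', -, h | h | h⟩ | ⟨ρ, hρ, h⟩) <;> rw [vec3_eq_iff] at h <;> omega)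
  have hreg : ∀ x y z : ℕ, v ![x, y, z] ≠ 0 → (x = y ∧ y = z) ∨ (y = z ∧ x < y) ∨ (x = z ∧ y < x) ∨ (x = y ∧ z < x) := by
    intro x y z hne
    by_contra hc
    refine hne (hzero _ ?_)
    rintro (h | ⟨s', hs', hs2, h | h | h⟩ | ⟨ρ, s', hρ, hs', hs2, h | h | h⟩ | ⟨ρ, hρ, h⟩) <;> rw [vec3_eq_iff] at h <;> omega
  -- (1) the glued rows in ★ FILE 1's currency
  have hG1' : ∀ ρ s, 1 ≤ ρ → 1 ≤ s → (fun r t => v ![r, t, t]) (2 * ρ) (2 * ρ + s) =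
      (if (i = 0) ∧ 2 ∣ s ∧ 2 * ρ ≤ min n₂ n₃ ∧ 2 * ρ + s ≤ n₁ ∧ 2 * ρ + ℓ₁ ≤ n₂ ∧ 2 * ρ + s + ℓ₁ ≤ n₁ ∧ 2 * ρ + ℓ₂ ≤ 2 * n₂ then
          ω * (q : ℚ) ^ (2 * ρ + s / 2 - 1) * ((if 2 * d ≤ s then (q : ℚ) - 1 else 0) - (if s + 2 = 2 * d then 1 else 0)) else 0) +
      (if 2 ∣ s ∧ n₂ = n₃ ∧ n₁ = n₂ + s ∧ n₂ < 2 * ρ + ℓ₁ ∧ ℓ₁ + ρ ≤ n₂ ∧ ℓ₁ + 2 * ρ - n₂ ≤ n₂ - d + 1 ∧ 2 * ρ + ℓ₂ ≤ 2 * n₂ then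
          (if (fun s c => (i = 0 → d ≤ s / 2 + c) ∧ (i ≠ 0 → d ≤ c)) s ((ℓ₁ + 2 * ρ - n₂ + 1) / 2) then εG 0 i else 0) *
            (q : ℚ) ^ (2 * ρ + s / 2 - (ℓ₁ + 2 * ρ - n₂ + 1) / 2) else 0) := by
    intro ρ s hρ hs
    simp only []
    rw [hG1 ρ s hρ hs, (vec_single_ite _ _ i).1, (vec_bracket_ite _ _ (εG 0) i).1]
    refine congrArg _ (ite_bracket_congr _ _ ?_)
    rintro ⟨⟨t', rfl⟩, -⟩
    constructor
    · rintro ⟨ha, hb⟩; exact ⟨fun h => by have := ha h; omega, fun h => by have := hb h; omega⟩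
    · rintro ⟨ha, hb⟩; exact ⟨fun h => by have := ha h; omega, fun h => by have := hb h; omega⟩
  have hG2' : ∀ ρ s, 1 ≤ ρ → 1 ≤ s → (fun r t => v ![t, r, t]) (2 * ρ) (2 * ρ + s) =
      (if (i = 1) ∧ 2 ∣ s ∧ 2 * ρ ≤ min n₁ n₃ ∧ 2 * ρ + s ≤ n₂ ∧ 2 * ρ + ℓ₁ ≤ n₁ ∧ 2 * ρ + s + ℓ₁ ≤ n₂ ∧ 2 * ρ + ℓ₂ ≤ 2 * n₁ then
          ω * (q : ℚ) ^ (2 * ρ + s / 2 - 1) * ((if 2 * d ≤ s then (q : ℚ) - 1 else 0) - (if s + 2 = 2 * d then 1 else 0)) else 0) +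
      (if 2 ∣ s ∧ n₁ = n₃ ∧ n₂ = n₁ + s ∧ n₁ < 2 * ρ + ℓ₁ ∧ ℓ₁ + ρ ≤ n₁ ∧ ℓ₁ + 2 * ρ - n₁ ≤ n₁ - d + 1 ∧ 2 * ρ + ℓ₂ ≤ 2 * n₁ then
          (if (fun s c => (i = 1 → d ≤ s / 2 + c) ∧ (i ≠ 1 → d ≤ c)) s ((ℓ₁ + 2 * ρ - n₁ + 1) / 2) then εG 1 i else 0) *
            (q : ℚ) ^ (2 * ρ + s / 2 - (ℓ₁ + 2 * ρ - n₁ + 1) / 2) else 0) := by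
    intro ρ s hρ hs
    simp only []
    rw [hG2 ρ s hρ hs, (vec_single_ite _ _ i).2.1, (vec_bracket_ite _ _ (εG 1) i).2.1]
    refine congrArg _ (ite_bracket_congr _ _ ?_)
    rintro ⟨⟨t', rfl⟩, -⟩
    constructor
    · rintro ⟨ha, hb⟩; exact ⟨fun h => by have := ha h; omega, fun h => by have := hb h; omega⟩
    · rintro ⟨ha, hb⟩; exact ⟨fun h => by have := ha h; omega, fun h => by have := hb h; omega⟩
  have hG3' : ∀ ρ s, 1 ≤ ρ → 1 ≤ s → (fun r t => v ![t, t, r]) (2 * ρ) (2 * ρ + s) =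
      (if (i = 2) ∧ 2 ∣ s ∧ 2 * ρ ≤ min n₁ n₂ ∧ 2 * ρ + s ≤ n₃ ∧ 2 * ρ + ℓ₁ ≤ n₂ ∧ 2 * ρ + s + ℓ₁ ≤ n₃ ∧ 2 * ρ + ℓ₂ ≤ 2 * n₂ then
          ω * (q : ℚ) ^ (2 * ρ + s / 2 - 1) * ((if 2 * d ≤ s then (q : ℚ) - 1 else 0) - (if s + 2 = 2 * d then 1 else 0)) else 0) +
      (if 2 ∣ s ∧ n₁ = n₂ ∧ n₃ = n₁ + s ∧ n₁ < 2 * ρ + ℓ₁ ∧ ℓ₁ + ρ ≤ n₁ ∧ ℓ₁ + 2 * ρ - n₁ ≤ n₁ - d + 1 ∧ 2 * ρ + ℓ₂ ≤ 2 * n₁ then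
          (if (fun s c => (i = 2 → d ≤ s / 2 + c) ∧ (i ≠ 2 → d ≤ c)) s ((ℓ₁ + 2 * ρ - n₁ + 1) / 2) then εG 2 i else 0) *
            (q : ℚ) ^ (2 * ρ + s / 2 - (ℓ₁ + 2 * ρ - n₁ + 1) / 2) else 0) := by
    intro ρ s hρ hs
    simp only []
    rw [hG3 ρ s hρ hs, (vec_single_ite _ _ i).2.2, (vec_bracket_ite _ _ (εG 2) i).2.2]
    refine congrArg _ (ite_bracket_congr _ _ ?_)
    rintro ⟨⟨t', rfl⟩, -⟩
    constructor
    · rintro ⟨ha, hb⟩; exact ⟨fun h => by have := ha h; omega, fun h => by have := hb h; omega⟩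
    · rintro ⟨ha, hb⟩; exact ⟨fun h => by have := ha h; omega, fun h => by have := hb h; omega⟩
  have hH' : ∀ ρ, 1 ≤ ρ → (fun r => v ![r, r, r]) (2 * ρ) =
      if (n₁ = n₂) ∧ (n₂ = n₃) ∧ n₁ < 2 * ρ + ℓ₁ ∧ ℓ₁ + 2 * ρ - n₁ ≤ n₁ - d + 1 ∧ d ≤ (ℓ₁ + 2 * ρ - n₁ + 1) / 2 ∧ ℓ₁ + ρ ≤ n₁ ∧ 2 * ρ + ℓ₂ ≤ 2 * n₁
        then εH * (q : ℚ) ^ (2 * ρ - (ℓ₁ + 2 * ρ - n₁ + 1) / 2) else 0 := by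
    intro ρ hρ
    simp only []
    exact hH ρ hρ
  -- (2) the box sum = diagonal window + three plane blocks (★ re-index + ★ FILE 1)
  rw [sum_box_eq_triple_sum, triple_sum_eq_diag_add_planes Bx v hreg,
    kappa_diag_sum_lev (q : ℚ) εH (n₁ = n₂) (n₂ = n₃) (m := n₁) (ℓ₁ := ℓ₁) (ℓ₂ := ℓ₂) (d := d) (by omega) (fun _ _ => by omega)
      (fun r => v ![r, r, r]) hcore hH' hz_diag,
    kappa_plane_sum_lev (q : ℚ) ω (εG 0 i) (i = 0) (fun s c => (i = 0 → d ≤ s / 2 + c) ∧ (i ≠ 0 → d ≤ c)) (n := n₁) (n' := n₂) (n'' := n₃) (nr := n₂)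
      hd (by omega) (by omega) (by omega) (by omega) (by omega) (fun r t => v ![r, t, t]) hT1 hG1' hz_p1,
    kappa_plane_sum_lev (q : ℚ) ω (εG 1 i) (i = 1) (fun s c => (i = 1 → d ≤ s / 2 + c) ∧ (i ≠ 1 → d ≤ c)) (n := n₂) (n' := n₁) (n'' := n₃) (nr := n₁)
      hd (by omega) (by omega) (by omega) (by omega) (by omega) (fun r t => v ![t, r, t]) hT2 hG2' hz_p2,
    kappa_plane_sum_lev (q : ℚ) ω (εG 2 i) (i = 2) (fun s c => (i = 2 → d ≤ s / 2 + c) ∧ (i ≠ 2 → d ≤ c)) (n := n₃) (n' := n₁) (n'' := n₂) (nr := n₂)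
      hd (by omega) (by omega) (by omega) (by omega) (by omega) (fun r t => v ![t, t, r]) hT3 hG3' hz_p3]
  clear hG1' hG2' hG3' hH' hG1 hG2 hG3 hT1 hT2 hT3 hH hzero hreg hz_diag hz_p1 hz_p2 hz_p3 hcore v
  exact hArith q d n₁ n₂ n₃ k ℓ₁ ℓ₂ i ω εH εG hd hiso ⟨hf1, hf2, hf3⟩ hℓ₁ hℓ₂ hcorner h1 h2 h3 hk hω0 hω1 hω2

/-- The narrow Prop ★ p860066 `LevLabelledBoxSum ℓ₁ ℓ₂` from the same arithmetic (★ `levLabelledBoxSum_of_wide`). [cite: Kottwitz1986BaseChangeUnits, §1 pp. 240–241] -/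
theorem levLabelledBoxSum_of_arith
    (hArith : ∀ (q d n₁ n₂ n₃ k ℓ₁ ℓ₂ : ℕ) (i : Fin 3) (ω εH : ℚ) (εG : Fin 3 → Fin 3 → ℚ),
      2 ≤ d → ((n₁ = n₂ ∧ n₁ ≤ n₃) ∨ (n₁ = n₃ ∧ n₁ ≤ n₂) ∨ (n₂ = n₃ ∧ n₂ ≤ n₁)) →
      (2 * d ≤ n₁ + 1 ∧ 2 * d ≤ n₂ + 1 ∧ 2 * d ≤ n₃ + 1) → ℓ₁ ≤ 2 → (ℓ₂ ≤ n₁ + ℓ₁ ∧ ℓ₂ ≤ n₂ + ℓ₁ ∧ ℓ₂ ≤ n₃ + ℓ₁) →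
      (d % 2 = 0 → ℓ₁ = 1 → d + 1 ≤ ℓ₂) → n₁ % 2 = d % 2 → n₂ % 2 = d % 2 → n₃ % 2 = d % 2 → 2 * k + d = n₁ + n₂ + n₃ + 2 →
      (i = 0 → n₂ = n₃ → n₂ + 2 * d ≤ n₁ → εG 0 0 = ω) → (i = 1 → n₁ = n₃ → n₁ + 2 * d ≤ n₂ → εG 1 1 = ω) →
      (i = 2 → n₁ = n₂ → n₁ + 2 * d ≤ n₃ → εG 2 2 = ω) →
      ((q : ℚ) - 1) *
          ((if n₁ = n₂ ∧ n₂ = n₃ then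
                  εH *
                    ∑
                      c ∈
                        Icc 1
                          (min (n₁ - ℓ₁ - (n₁ - ℓ₁) / 2)
                            (min ((2 * n₁ - ℓ₂) / 2 - (n₁ - ℓ₁) / 2) ((2 * n₁ - d + 1 - ℓ₁) / 2 - (n₁ - ℓ₁) / 2))),
                      if d ≤ c then (q : ℚ) ^ (2 * ((n₁ - ℓ₁) / 2) + c) else 0
                else 0) +
                ((if i = 0 then
                    ω *
                      (∑ j ∈ Icc d ((n₁ - ℓ₁) / 2), (q : ℚ) ^ j +
                        ∑ ρ ∈ Icc 1 (min (min n₂ n₃) (min (n₂ - ℓ₁) (2 * n₂ - ℓ₂)) / 2),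
                          ((if ρ + d ≤ (n₁ - ℓ₁) / 2 then (q : ℚ) ^ ((n₁ - ℓ₁) / 2 + ρ) - (q : ℚ) ^ (2 * ρ + d - 1) else 0) -
                            if ρ + d ≤ (n₁ - ℓ₁) / 2 + 1 then (q : ℚ) ^ (2 * ρ + d - 2) else 0))
                  else 0) +
                  if n₂ = n₃ ∧ n₂ < n₁ ∧ (n₁ - n₂) % 2 = 0 then
                    εG 0 i *
                      ∑
                        c ∈
                          Icc 1
                            (min (n₂ - ℓ₁ - (n₂ - ℓ₁) / 2)
                              (min ((2 * n₂ - ℓ₂) / 2 - (n₂ - ℓ₁) / 2) ((2 * n₂ - d + 1 - ℓ₁) / 2 - (n₂ - ℓ₁) / 2))),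
                        if (i = 0 → d ≤ (n₁ - n₂) / 2 + c) ∧ (i ≠ 0 → d ≤ c) then
                          (q : ℚ) ^ (2 * ((n₂ - ℓ₁) / 2) + (n₁ - n₂) / 2 + c)
                        else 0
                  else 0) +
              ((if i = 1 then
                  ω *
                    (∑ j ∈ Icc d ((n₂ - ℓ₁) / 2), (q : ℚ) ^ j +
                      ∑ ρ ∈ Icc 1 (min (min n₁ n₃) (min (n₁ - ℓ₁) (2 * n₁ - ℓ₂)) / 2),
                        ((if ρ + d ≤ (n₂ - ℓ₁) / 2 then (q : ℚ) ^ ((n₂ - ℓ₁) / 2 + ρ) - (q : ℚ) ^ (2 * ρ + d - 1) else 0) -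
                          if ρ + d ≤ (n₂ - ℓ₁) / 2 + 1 then (q : ℚ) ^ (2 * ρ + d - 2) else 0))
                else 0) +
                if n₁ = n₃ ∧ n₁ < n₂ ∧ (n₂ - n₁) % 2 = 0 then
                  εG 1 i *
                    ∑
                      c ∈
                        Icc 1
                          (min (n₁ - ℓ₁ - (n₁ - ℓ₁) / 2)
                            (min ((2 * n₁ - ℓ₂) / 2 - (n₁ - ℓ₁) / 2) ((2 * n₁ - d + 1 - ℓ₁) / 2 - (n₁ - ℓ₁) / 2))),
                      if (i = 1 → d ≤ (n₂ - n₁) / 2 + c) ∧ (i ≠ 1 → d ≤ c) then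
                        (q : ℚ) ^ (2 * ((n₁ - ℓ₁) / 2) + (n₂ - n₁) / 2 + c)
                      else 0
                else 0) +
            ((if i = 2 then
                ω *
                  (∑ j ∈ Icc d ((n₃ - ℓ₁) / 2), (q : ℚ) ^ j +
                    ∑ ρ ∈ Icc 1 (min (min n₁ n₂) (min (n₂ - ℓ₁) (2 * n₂ - ℓ₂)) / 2),
                      ((if ρ + d ≤ (n₃ - ℓ₁) / 2 then (q : ℚ) ^ ((n₃ - ℓ₁) / 2 + ρ) - (q : ℚ) ^ (2 * ρ + d - 1) else 0) -
                        if ρ + d ≤ (n₃ - ℓ₁) / 2 + 1 then (q : ℚ) ^ (2 * ρ + d - 2) else 0))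
              else 0) +
              if n₁ = n₂ ∧ n₁ < n₃ ∧ (n₃ - n₁) % 2 = 0 then
                εG 2 i *
                  ∑
                    c ∈
                      Icc 1
                        (min (n₁ - ℓ₁ - (n₁ - ℓ₁) / 2)
                          (min ((2 * n₁ - ℓ₂) / 2 - (n₁ - ℓ₁) / 2) ((2 * n₁ - d + 1 - ℓ₁) / 2 - (n₁ - ℓ₁) / 2))),
                    if (i = 2 → d ≤ (n₃ - n₁) / 2 + c) ∧ (i ≠ 2 → d ≤ c) then (q : ℚ) ^ (2 * ((n₁ - ℓ₁) / 2) + (n₃ - n₁) / 2 + c)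
                    else 0
              else 0)) =
        (if n₁ = n₂ ∧ n₂ = n₃ then εH else if n₂ = n₃ then εG 0 i else if n₁ = n₃ then εG 1 i else εG 2 i) *
          ((q : ℚ) ^ (k - max ℓ₁ ((ℓ₂ + 1) / 2 - d / 2 + (ℓ₁ + 1 - d % 2) / 2)) -
            (q : ℚ) ^
              (k -
                max (max ℓ₁ ((ℓ₂ + 1) / 2 - d / 2 + (ℓ₁ + 1 - d % 2) / 2))
                  (((![n₁, n₂, n₃] : Fin 3 → ℕ) i + 2 * (d % 2) + 2 - 3 * d) / 2 + 2 * ((ℓ₁ + 1 - d % 2) / 2)))))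
    (ℓ₁ ℓ₂ : ℕ) : LevLabelledBoxSum ℓ₁ ℓ₂ :=
  levLabelledBoxSum_of_wide ℓ₁ ℓ₂ (levLabelledBoxSumWide_of_arith hArith ℓ₁ ℓ₂)

end Summit.HodgeConjecture.HodgeConjecture.Cruxes.H413.F0P3cDyRamLevLabelledKappaBoxSum
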